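import Literature.MathematicalPhysics.QuantumFieldTheory.ConformalBootstrap3D.PointKernelK57Data
import Literature.MathematicalPhysics.QuantumFieldTheory.ConformalBootstrap3D.PointKernelParts

/-!
# K57 certificate, kernel part file P3: one-cell head segments 146, 147 in level ranges

The head cells whose kernel evaluation exceeds one `decide` are one-cell segments of `hsegsK57`; each is
checked by `PCert.hPartSideOK` (side conditions) and `PCert.hPartOK` per level range `[n_lo, n_lo + count)`
against an integer claim, the claims summing to `≥ 0` (`PointKernel.partsOK`); soundness is
`PCert.hParts_sound` (`PointKernelParts`).  The part files `P1, P2, …` are mutually independent (each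
imports only the data file); the ranges of one cell may span several of them, and the per-cell
conclusions `hparts_i` / `hcell_i` of those cells are assembled in `PointKernelK57.lean`.
Estimated kernel time 204 s.
-/

set_option maxRecDepth 100000
set_option maxHeartbeats 0

namespace Literature.MathematicalPhysics.QuantumFieldTheory.ConformalBootstrap3D.PointKernelK57

open Literature.MathematicalPhysics.QuantumFieldTheory.ConformalBootstrap3D.PointKernel

/-- levels `[58, 60)` of segment 146: partial lower sum `≥` claim. [folklore] -/
theorem part_146_9 : certK57.hPartOK (PCert.segAt hsegsK57 146) JHK57 58 2 (65121368448368592291194563230263668) = true := by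
  decide +kernel

/-- levels `[60, 62)` of segment 146: partial lower sum `≥` claim. [folklore] -/
theorem part_146_10 : certK57.hPartOK (PCert.segAt hsegsK57 146) JHK57 60 2 (48902677871720494919926011399525178) = true := by
  decide +kernel

/-- levels `[62, 64)` of segment 146: partial lower sum `≥` claim. [folklore] -/
theorem part_146_11 : certK57.hPartOK (PCert.segAt hsegsK57 146) JHK57 62 2 (35961094800670712551547415640990458) = true := by
  decide +kernel

/-- levels `[64, 65)` of segment 146: partial lower sum `≥` claim. [folklore] -/
theorem part_146_12 : certK57.hPartOK (PCert.segAt hsegsK57 146) JHK57 64 1 (6458521416051678057231997606066631) = true := by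
  decide +kernel

/-- one-cell segment 147 (row 6, cell `[7169/1024, 3585/512]`, chord, `n_F = 56`,
7 level ranges): side conditions. [folklore] -/
theorem pside_147 : certK57.hPartSideOK (PCert.segAt hsegsK57 147) JHK57 = true := by
  decide +kernel

/-- its level ranges `(n_lo, count, claim)`. [folklore] -/
def parts_147 : List (ℕ × ℕ × ℤ) := [(0, 24, -14742193097524724002760397572079879572), (24, 10, 9549580786694959045325315748461006583), (34, 7, 3067816386986253850618334182230027523), (41, 6, 1284625265016849237417688809405220777), (47, 5, 561722356107473573495561757065915660), (52, 4, 254576276145440531769542113502664822), (56, 1, 23872026573747764133954961415044208)]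

/-- the ranges tile `[0, n_F]` and the claims sum to `≥ 0`. [folklore] -/
theorem pcov_147 : PointKernel.partsOK 56 parts_147 = true := by
  decide +kernel

end Literature.MathematicalPhysics.QuantumFieldTheory.ConformalBootstrap3D.PointKernelK57
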